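import Summits.BirchSwinnertonDyer.Rank1Residual.X1.GeneratorCountLayerTransportTorsion
import Summits.BirchSwinnertonDyer.Rank1Residual.Additive.RationalClassesToLayerZero
import HarnessLib

/-!
# Route M's generator COUNT at LAYER `n`, V: classes over `K_n` counted in the `K`-FRAMEWORK —
# the local condition at the place above `p` imposed over `K_∞`, not over `K_{n,∞}`
# (cell `b2b-bsdres`, unit `b2b-bsdres-eisenstein-p1`, gen 19; X1R0-GAPMAP §28, memo
# `V76-LOCAL-TERM-PLAN.md` §4.5 route R1′, steps (P2)–(P3))

HONEST FRAMING (run/shared/lean/b2b/bsd-rank1-residual/, verbatim in every file): the goal of the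
cell is to DELETE the COMBINATION-SHAPED residual classes of the Birch–Swinnerton-Dyer formula for
ALL analytic-rank `≤ 1` elliptic curves over `ℚ` — "full BSD formula for every rank `≤ 1` curve in
class `C`" assembled STRICTLY from published theorems — so that the rank-`≤ 1` remainder becomes
exactly the CONSTRUCTION-SHAPED classes, which are TYPED (missing-input `Prop`s), NOT attempted.
This is not "finishing BSD". Sub-cell `b2b-bsdres-eisenstein-p1` (CLASS-OWNERS row "X1 (r = 0)"):
research route; NO CLAIM BEYOND STATED CLASSES; nothing here changes a label; nothing is booked.
THEOREMS ONLY — no definition, no named fact, no typed input introduced; nothing about any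
particular curve asserted.

## What and why

FILES 6/8/9 (gen 17) count classes `y ∈ H¹(K_n, E[p])` by `X/(p, ω_n)X` after the transport
`kerH1Iso ∘ h'_0` into `Sel_{p^∞}(E/K_∞)`, and to get INTO `Sel_{p^∞}` they ask the local condition
of `h'_0(Ψ y)` over `K_{n,∞}` at EVERY place of `K_n` (n1011's `kerH1Iso_mem_selmerInfty`) — at the
prime `𝔭` of `K_n` above `p` this is the hypothesis `hloc` of FILE 9 §3, which the typed Prop. 2.4
(stated over `ℚ`, `X1/StrictAtPOfInertia*`) does NOT deliver: it delivers the condition of the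
TRANSPORTED class over `K_∞ = ℚ_∞` at the place of `K` (memo §4.3, §4.5). Route R1′: impose the
condition at the special place `v₀` of `K` directly in the `K`-framework and keep the `K_n`-framework
conditions only at the places of `K_n` NOT above `v₀`:

* §1 (K-general, n1011's generic local step run per place): `kerH1Iso x` satisfies the local
  condition over `K` at every embedding above a finite `v` as soon as all `Γ_{K_n}`-conjugates of `x`
  satisfy the `K_n`-condition at the places `w ∣ v` (`…_of_liesOver`), idem at `∞`; hence
  **`kerH1Iso x ∈ Sel_{p^∞}(E/K_∞)`** from: the `K_n`-conditions at the finite `w ∤ v₀` and at `∞`,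
  and the `K`-condition at `v₀` for all `Γ_K`-conjugates of `kerH1Iso x`
  (`kerH1Iso_mem_selmerInfty_of_local`).
* §2: for level-`0` classes `x = h'_0 z`, `z ∈ H¹(K_n, E[p^∞])`, the `Γ_{K_n}`-conjugates are absorbed
  (`conjH1_layerToInfty_zero`).
* The COUNTS (`#S ≤ #(X/I_nX) · (#E[p^∞]^{Γ_{K_n}})²`, and `#S ≤ #(X/I_nX)` when `E(K)[p] = 0`, for
  a finite `S ≤ H¹(K_n, E[p])` with these local hypotheses) are the sequel file
  `X1/GeneratorCountLayerLocal.lean`.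

Over `ℚ` with `κ` cyclotomic and `v₀ = p` the conjugates at `v₀` are free (FILE 22
`X1/LocalKerOverAtPConj`) and the `K`-condition at `p` is the socket FILE 21; the assembly is the
sequel file. Nothing is booked by this file.

References: [GreenbergLNM1716] §1 p. 60, §2, §3 pp. 85–86 (Lemma 3.1), §5 pp. 114–118;
[SerreGaloisCohomology1997] I.§2.4–2.5, II.§1.1; [Mazur1972] §6; X1R0-GAPMAP §26–§28.
-/

noncomputable section

open scoped Classical

open Function Field NumberField IsDedekindDomain WeierstrassCurve PowerSeries
  Literature.NumberTheory.EllipticCurves Literature.NumberTheory.GaloisRepresentations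
  Literature.NumberTheory.GaloisCohomology
  Literature.NumberTheory.EllipticCurves.IwasawaAlgebra IsLocalRing
  Summit.BirchSwinnertonDyer.Rank1Residual.Additive
  Summit.BirchSwinnertonDyer.Rank1Residual.Additive.ZpTower
  Summit.BirchSwinnertonDyer.Rank1Residual.Additive.LocalTransport
  Summit.BirchSwinnertonDyer.Rank1Residual.X1.GeneratorCountLayer
  Summit.BirchSwinnertonDyer.Rank1Residual.X1.GeneratorBoundMuLayer

set_option autoImplicit false

universe u

namespace Summit.BirchSwinnertonDyer.Rank1Residual.X1.LayerClassesToSelmerInfty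

/-! ## §1. Transport into `Sel_{p^∞}(E/K_∞)` with the `K`-framework condition at one place -/

section Transport

variable {K : Type u} [Field K] [NumberField K] {p : ℕ} [Fact p.Prime]
variable (W : WeierstrassCurve K) (κ : ZpExtension K p) (n : ℕ) (κn : ZpExtension (κ.layer n) p)
  (hκn : ∀ σ : Field.absoluteGaloisGroup (κ.layer n),
    (κn σ).toAdd * (p : ℤ_[p]) ^ n = (κ (resGal (K := K) (κ.layer n) σ)).toAdd)

/-- **Finite places, per place.** As n1011's `kerH1Iso_mem_localKerOverOfEmb_adicCompletion`, but
asking the `K_n`-local condition (for all `Γ_{K_n}`-conjugates) only at the places `w ∣ v`: for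
every `K`-embedding `ι : K̄ → K̄_v`, `kerH1Iso x ∈ localKerOverOfEmb p (ker κ) ι` — the embedding
`ι ∘ ι_{K_n}⁻¹|_{K_n}` factors through some `K_{n,w}`, `w ∣ v` (`exists_place_factorisation`), and the
generic local step applies there. [cite: GreenbergLNM1716, §2] [cite: SerreGaloisCohomology1997, II.§1.1] -/
theorem kerH1Iso_mem_localKerOverOfEmb_adicCompletion_of_liesOver (v : HeightOneSpectrum (𝓞 K))
    (ι : AlgebraicClosure K →ₐ[K] AlgebraicClosure (v.adicCompletion K))
    (x : (W.baseChange (κ.layer n)).subgroupH1 p κn.kerSubgroup)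
    (hx : ∀ w : HeightOneSpectrum (𝓞 (κ.layer n)), w.asIdeal.LiesOver v.asIdeal →
      ∀ σ : Field.absoluteGaloisGroup (κ.layer n),
        (W.baseChange (κ.layer n)).conjH1 p κn.kerSubgroup σ x ∈
          (W.baseChange (κ.layer n)).localKerOver p κn.kerSubgroup (w.adicCompletion (κ.layer n))) :
    kerH1Iso W κ n κn hκn x ∈ W.localKerOverOfEmb p κ.kerSubgroup ι := by
  let ιL : AlgebraicClosure K ≃ₐ[K] AlgebraicClosure (κ.layer n) :=
    algEquivOfEmb (κ.layer n) (closureEmb (K := K) (κ.layer n))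
  let φ : κ.layer n →+* AlgebraicClosure (v.adicCompletion K) :=
    ι.toRingHom.comp ((ιL.symm : AlgebraicClosure (κ.layer n) →+* AlgebraicClosure K).comp
      (algebraMap (κ.layer n) (AlgebraicClosure (κ.layer n))))
  have hφapply : ∀ l, φ l = ι (ιL.symm (algebraMap (κ.layer n) (AlgebraicClosure (κ.layer n)) l)) :=
    fun _ ↦ rfl
  have hφ : φ.comp (algebraMap K (κ.layer n)) =
      (algebraMap (v.adicCompletion K) (AlgebraicClosure (v.adicCompletion K))).comp
        (algebraMap K (v.adicCompletion K)) := by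
    ext y
    change φ (algebraMap K (κ.layer n) y) =
      algebraMap (v.adicCompletion K) _ (algebraMap K (v.adicCompletion K) y)
    rw [hφapply, ← IsScalarTower.algebraMap_apply K (κ.layer n) (AlgebraicClosure (κ.layer n)),
      AlgEquiv.commutes, AlgHom.commutes, ← IsScalarTower.algebraMap_apply]
  obtain ⟨w, hw, ε, hεf, hεφ⟩ := exists_place_factorisation (κ.layer n) v
    (algebraMap (v.adicCompletion K) (AlgebraicClosure (v.adicCompletion K))) φ hφ
  exact kerH1Iso_mem_localKerOverOfEmb_of_factorisation W κ n κn hκn ι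
    (adicCompletionMap (K := K) (κ.layer n) v w) ε hεf
    (fun l ↦ (RingHom.congr_fun hεφ l).trans (hφapply l))
    (closure_range_adicCompletionMap_union_eq_top (κ.layer n) v w) x (hx w hw)

/-- The same in the `conj_σ` form of `mem_selmerGroupOver_iff` (`localKerOverOfEmb_comp`).
[cite: GreenbergLNM1716, §2] -/
theorem conjH1_kerH1Iso_mem_localKerOver_adicCompletion_of_liesOver (v : HeightOneSpectrum (𝓞 K))
    (σ : Field.absoluteGaloisGroup K) (x : (W.baseChange (κ.layer n)).subgroupH1 p κn.kerSubgroup)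
    (hx : ∀ w : HeightOneSpectrum (𝓞 (κ.layer n)), w.asIdeal.LiesOver v.asIdeal →
      ∀ σ : Field.absoluteGaloisGroup (κ.layer n),
        (W.baseChange (κ.layer n)).conjH1 p κn.kerSubgroup σ x ∈
          (W.baseChange (κ.layer n)).localKerOver p κn.kerSubgroup (w.adicCompletion (κ.layer n))) :
    W.conjH1 p κ.kerSubgroup σ (kerH1Iso W κ n κn hκn x) ∈
      W.localKerOver p κ.kerSubgroup (v.adicCompletion K) := by
  have h := kerH1Iso_mem_localKerOverOfEmb_adicCompletion_of_liesOver W κ n κn hκn v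
    ((closureEmb (K := K) (v.adicCompletion K)).comp
      ((show AlgebraicClosure K ≃ₐ[K] AlgebraicClosure K from σ) :
        AlgebraicClosure K →ₐ[K] AlgebraicClosure K)) x hx
  rw [W.localKerOverOfEmb_comp p κ.kerSubgroup, AddSubgroup.mem_comap] at h
  rw [WeierstrassCurve.localKerOver_eq_ofEmb]
  exact h

/-- **Infinite places, per place**: as n1011's `kerH1Iso_mem_localKerOverOfEmb_infinitePlace` with
the `K_n`-local condition asked at the infinite places only. [cite: GreenbergLNM1716, §2] -/
theorem kerH1Iso_mem_localKerOverOfEmb_infinitePlace_of_forall (v : InfinitePlace K)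
    (ι : AlgebraicClosure K →ₐ[K] AlgebraicClosure v.Completion)
    (x : (W.baseChange (κ.layer n)).subgroupH1 p κn.kerSubgroup)
    (hx : ∀ (w : InfinitePlace (κ.layer n)) (σ : Field.absoluteGaloisGroup (κ.layer n)),
      (W.baseChange (κ.layer n)).conjH1 p κn.kerSubgroup σ x ∈
        (W.baseChange (κ.layer n)).localKerOver p κn.kerSubgroup w.Completion) :
    kerH1Iso W κ n κn hκn x ∈ W.localKerOverOfEmb p κ.kerSubgroup ι := by
  let ιL : AlgebraicClosure K ≃ₐ[K] AlgebraicClosure (κ.layer n) :=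
    algEquivOfEmb (κ.layer n) (closureEmb (K := K) (κ.layer n))
  let φ : κ.layer n →+* AlgebraicClosure v.Completion :=
    ι.toRingHom.comp ((ιL.symm : AlgebraicClosure (κ.layer n) →+* AlgebraicClosure K).comp
      (algebraMap (κ.layer n) (AlgebraicClosure (κ.layer n))))
  have hφapply : ∀ l, φ l = ι (ιL.symm (algebraMap (κ.layer n) (AlgebraicClosure (κ.layer n)) l)) :=
    fun _ ↦ rfl
  have hφ : φ.comp (algebraMap K (κ.layer n)) =
      (algebraMap v.Completion (AlgebraicClosure v.Completion)).comp
        (algebraMap K v.Completion) := by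
    ext y
    change φ (algebraMap K (κ.layer n) y) =
      algebraMap v.Completion _ (algebraMap K v.Completion y)
    rw [hφapply, ← IsScalarTower.algebraMap_apply K (κ.layer n) (AlgebraicClosure (κ.layer n)),
      AlgEquiv.commutes, AlgHom.commutes, ← IsScalarTower.algebraMap_apply]
  obtain ⟨w, hw, ε, hεf, hεφ⟩ := exists_infinitePlace_factorisation (κ.layer n) v
    (algebraMap v.Completion (AlgebraicClosure v.Completion)) φ hφ
  haveI : IsScalarTower K (κ.layer n) w.Completion := isScalarTower_completion (κ.layer n) w
  exact kerH1Iso_mem_localKerOverOfEmb_of_factorisation W κ n κn hκn ι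
    (NumberField.LiesOver.completionMap (v := v) (w := w)) ε hεf
    (fun l ↦ (RingHom.congr_fun hεφ l).trans (hφapply l))
    (closure_range_completionMap_union_eq_top (κ.layer n) v w) x (hx w)

/-- The same in the `conj_σ` form at the infinite places. [cite: GreenbergLNM1716, §2] -/
theorem conjH1_kerH1Iso_mem_localKerOver_infinitePlace_of_forall (v : InfinitePlace K)
    (σ : Field.absoluteGaloisGroup K) (x : (W.baseChange (κ.layer n)).subgroupH1 p κn.kerSubgroup)
    (hx : ∀ (w : InfinitePlace (κ.layer n)) (σ : Field.absoluteGaloisGroup (κ.layer n)),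
      (W.baseChange (κ.layer n)).conjH1 p κn.kerSubgroup σ x ∈
        (W.baseChange (κ.layer n)).localKerOver p κn.kerSubgroup w.Completion) :
    W.conjH1 p κ.kerSubgroup σ (kerH1Iso W κ n κn hκn x) ∈
      W.localKerOver p κ.kerSubgroup v.Completion := by
  have h := kerH1Iso_mem_localKerOverOfEmb_infinitePlace_of_forall W κ n κn hκn v
    ((closureEmb (K := K) v.Completion).comp
      ((show AlgebraicClosure K ≃ₐ[K] AlgebraicClosure K from σ) :
        AlgebraicClosure K →ₐ[K] AlgebraicClosure K)) x hx
  rw [W.localKerOverOfEmb_comp p κ.kerSubgroup, AddSubgroup.mem_comap] at h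
  rw [WeierstrassCurve.localKerOver_eq_ofEmb]
  exact h

omit [NumberField K] in
/-- A place of `K_n` lies over only one place of `K`. [folklore] -/
theorem eq_of_liesOver_of_liesOver {w : HeightOneSpectrum (𝓞 (κ.layer n))}
    {v v₀ : HeightOneSpectrum (𝓞 K)} (hv : w.asIdeal.LiesOver v.asIdeal)
    (hv₀ : w.asIdeal.LiesOver v₀.asIdeal) : v = v₀ := by
  apply HeightOneSpectrum.ext
  rw [hv.over, hv₀.over]

/-- **`kerH1Iso x ∈ Sel_{p^∞}(E/K_∞)` with the `K`-FRAMEWORK condition at one place `v₀`.** If all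
`Γ_{K_n}`-conjugates of `x ∈ H¹(K_{n,∞}, E[p^∞])` satisfy the `K_n`-local condition at every finite
place of `K_n` NOT above `v₀` and at every infinite place, and all `Γ_K`-conjugates of `kerH1Iso x`
satisfy the `K`-local condition at `v₀`, then `kerH1Iso x ∈ Sel_{p^∞}(E/K_∞)` (`= W.selmerInfty κ`).
[cite: GreenbergLNM1716, §2] [cite: Mazur1972, §6] -/
theorem kerH1Iso_mem_selmerInfty_of_local (x : (W.baseChange (κ.layer n)).subgroupH1 p κn.kerSubgroup)
    (v₀ : HeightOneSpectrum (𝓞 K))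
    (hfin : ∀ w : HeightOneSpectrum (𝓞 (κ.layer n)), ¬ w.asIdeal.LiesOver v₀.asIdeal →
      ∀ σ : Field.absoluteGaloisGroup (κ.layer n),
        (W.baseChange (κ.layer n)).conjH1 p κn.kerSubgroup σ x ∈
          (W.baseChange (κ.layer n)).localKerOver p κn.kerSubgroup (w.adicCompletion (κ.layer n)))
    (hinf : ∀ (w : InfinitePlace (κ.layer n)) (σ : Field.absoluteGaloisGroup (κ.layer n)),
      (W.baseChange (κ.layer n)).conjH1 p κn.kerSubgroup σ x ∈
        (W.baseChange (κ.layer n)).localKerOver p κn.kerSubgroup w.Completion)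
    (hv₀ : ∀ σ : Field.absoluteGaloisGroup K, W.conjH1 p κ.kerSubgroup σ (kerH1Iso W κ n κn hκn x) ∈
      W.localKerOver p κ.kerSubgroup (v₀.adicCompletion K)) :
    kerH1Iso W κ n κn hκn x ∈ W.selmerInfty κ := by
  change kerH1Iso W κ n κn hκn x ∈ W.selmerGroupOver p κ.kerSubgroup
  rw [WeierstrassCurve.mem_selmerGroupOver_iff]
  refine ⟨fun v σ ↦ ?_,
    fun v σ ↦ conjH1_kerH1Iso_mem_localKerOver_infinitePlace_of_forall W κ n κn hκn v σ x hinf⟩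
  by_cases hv : v = v₀
  · subst hv; exact hv₀ σ
  · exact conjH1_kerH1Iso_mem_localKerOver_adicCompletion_of_liesOver W κ n κn hκn v σ x
      fun w hw σ' ↦ hfin w (fun hw₀ ↦ hv (eq_of_liesOver_of_liesOver κ n hw hw₀)) σ'

/-! ## §2. Level-`0` classes over `K_n` -/

/-- **For a level-`0` class `z ∈ H¹(K_n, E[p^∞])`**: `kerH1Iso (h'_0 z) ∈ Sel_{p^∞}(E/K_∞)` as soon as
`h'_0 z` satisfies the `K_n`-local condition at the finite places not above `v₀` and at `∞` (its
`Γ_{K_n}`-conjugates are itself, `conjH1_layerToInfty_zero`) and all `Γ_K`-conjugates of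
`kerH1Iso (h'_0 z)` satisfy the `K`-local condition at `v₀`. [cite: GreenbergLNM1716, §2, §3 p. 85] -/
theorem kerH1Iso_layerToInfty_mem_selmerInfty_of_local
    (z : (W.baseChange (κ.layer n)).subgroupH1 p (κn.layerSubgroup 0)) (v₀ : HeightOneSpectrum (𝓞 K))
    (hfin : ∀ w : HeightOneSpectrum (𝓞 (κ.layer n)), ¬ w.asIdeal.LiesOver v₀.asIdeal →
      (W.baseChange (κ.layer n)).layerToInfty κn 0 z ∈
        (W.baseChange (κ.layer n)).localKerOver p κn.kerSubgroup (w.adicCompletion (κ.layer n)))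
    (hinf : ∀ w : InfinitePlace (κ.layer n), (W.baseChange (κ.layer n)).layerToInfty κn 0 z ∈
      (W.baseChange (κ.layer n)).localKerOver p κn.kerSubgroup w.Completion)
    (hv₀ : ∀ σ : Field.absoluteGaloisGroup K, W.conjH1 p κ.kerSubgroup σ
        (kerH1Iso W κ n κn hκn ((W.baseChange (κ.layer n)).layerToInfty κn 0 z)) ∈
      W.localKerOver p κ.kerSubgroup (v₀.adicCompletion K)) :
    kerH1Iso W κ n κn hκn ((W.baseChange (κ.layer n)).layerToInfty κn 0 z) ∈ W.selmerInfty κ := by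
  refine kerH1Iso_mem_selmerInfty_of_local W κ n κn hκn _ v₀ (fun w hw σ ↦ ?_) (fun w σ ↦ ?_) hv₀
  · rw [conjH1_layerToInfty_zero]; exact hfin w hw
  · rw [conjH1_layerToInfty_zero]; exact hinf w

end Transport

end Summit.BirchSwinnertonDyer.Rank1Residual.X1.LayerClassesToSelmerInfty

end
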